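import Summits.QuantumFields.YangMills.Theorems.RationalShortRootRigidityHyperplaneVanishing
import HarnessLib

/-!
# `RationalShortRootRigidity` — Step 2 assembly helpers (§A, §C, §D of the `stub_planar` plan): the planar restriction

Helper lemmas INSIDE the paper proof of crux `stmt-QuantumFields-23124` (`F4SubCurvatureDoor.RationalShortRootRigidity`,
LINE g15-A of planner ym-idea-3; owner's assembly plan HOME l15/STUB-PLAN-Planar.md).  The planar restriction of `D ∈ ℝ[p₀,…,p₃]` to
the affine plane `x e₀ + y f + q₀` is the substitution `bind₁ g D`, `g 0 = X 0`, `g i = C a · X 1 + C (q₀ i)` (`i ≠ 0`; `a = 1/√3`):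

* `eval_planarRestriction` — its values: `b(x,y) = D(x, a y + q₀ 1, a y + q₀ 2, a y + q₀ 3)`;
* `totalDegree_planarRestriction_le` — `totalDegree b ≤ totalDegree D`;
* `coeff_fibre_top`, `coeff_top_planarRestriction` (§C) — the `x^N`-coefficient of `b` is the `p₀^N`-coefficient of `D` (`N ≥ deg D`);
* `planarRestriction_roots_imaginary` (§D) — `WickAlong e₀ D` (unfolded) gives: for every real `y`, all complex roots `z` of `b(z,y)` are
  purely imaginary (the hypothesis of `topForm_roots_imaginary`, p671114).

Mathlib + `eval_bind₁_gen` (p665739); THEOREMS ONLY; no named facts; no `sorry`; default heartbeats.  Nothing about the crux 23124, the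
route's rung or the Yang–Mills mass gap is proved here.  Free-hands seat `ym-line-frs-p2` g10, `--supports stmt-QuantumFields-23124`.
-/

set_option autoImplicit false

namespace Summit.QuantumFields.YangMills.Theorems.RationalShortRootRigidity

open Polynomial
open scoped BigOperators Polynomial

/-- Values of the planar restriction. [folklore] -/
theorem eval_planarRestriction (D : MvPolynomial (Fin 4) ℝ) (a : ℝ) (q₀ : Fin 4 → ℝ) (v : Fin 2 → ℝ) :
    MvPolynomial.eval v (MvPolynomial.bind₁ (fun i : Fin 4 => if i = 0 then (MvPolynomial.X 0 : MvPolynomial (Fin 2) ℝ)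
      else MvPolynomial.C a * MvPolynomial.X 1 + MvPolynomial.C (q₀ i)) D) =
    MvPolynomial.eval (fun i : Fin 4 => if i = 0 then v 0 else a * v 1 + q₀ i) D := by
  have key : MvPolynomial.eval v (MvPolynomial.bind₁ (fun i : Fin 4 => if i = 0 then (MvPolynomial.X 0 : MvPolynomial (Fin 2) ℝ)
      else MvPolynomial.C a * MvPolynomial.X 1 + MvPolynomial.C (q₀ i)) D) =
      MvPolynomial.eval (fun i : Fin 4 => MvPolynomial.eval v ((fun i : Fin 4 => if i = 0 then
        (MvPolynomial.X 0 : MvPolynomial (Fin 2) ℝ) else MvPolynomial.C a * MvPolynomial.X 1 + MvPolynomial.C (q₀ i)) i)) D :=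
    MvPolynomial.eval₂Hom_bind₁ _ _ _ _
  have hpt : (fun i : Fin 4 => MvPolynomial.eval v ((fun i : Fin 4 => if i = 0 then
      (MvPolynomial.X 0 : MvPolynomial (Fin 2) ℝ) else MvPolynomial.C a * MvPolynomial.X 1 + MvPolynomial.C (q₀ i)) i)) =
      fun i : Fin 4 => if i = 0 then v 0 else a * v 1 + q₀ i := by
    funext i
    by_cases hi : i = 0
    · simp only [hi, if_true, MvPolynomial.eval_X]
    · simp only [hi, if_false, map_add, map_mul, MvPolynomial.eval_C, MvPolynomial.eval_X]
  rw [key, hpt]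

/-- The planar restriction does not raise the total degree. [folklore] -/
theorem totalDegree_planarRestriction_le (D : MvPolynomial (Fin 4) ℝ) (a : ℝ) (q₀ : Fin 4 → ℝ) :
    (MvPolynomial.bind₁ (fun i : Fin 4 => if i = 0 then (MvPolynomial.X 0 : MvPolynomial (Fin 2) ℝ)
      else MvPolynomial.C a * MvPolynomial.X 1 + MvPolynomial.C (q₀ i)) D).totalDegree ≤ D.totalDegree := by
  classical
  have hg : ∀ i : Fin 4, ((fun i : Fin 4 => if i = 0 then (MvPolynomial.X 0 : MvPolynomial (Fin 2) ℝ)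
      else MvPolynomial.C a * MvPolynomial.X 1 + MvPolynomial.C (q₀ i)) i).totalDegree ≤ 1 := by
    intro i
    by_cases hi : i = 0
    · simp only [hi, if_true, MvPolynomial.totalDegree_X]; exact le_rfl
    · simp only [hi, if_false]
      refine (MvPolynomial.totalDegree_add _ _).trans (max_le ?_ ?_)
      · exact (MvPolynomial.totalDegree_mul _ _).trans (by rw [MvPolynomial.totalDegree_C, MvPolynomial.totalDegree_X])
      · rw [MvPolynomial.totalDegree_C]; exact Nat.zero_le _
  conv_lhs => rw [D.as_sum, map_sum]
  refine (MvPolynomial.totalDegree_finsetSum _ _).trans (Finset.sup_le fun d hd => ?_)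
  rw [MvPolynomial.bind₁_monomial]
  refine (MvPolynomial.totalDegree_mul _ _).trans ?_
  rw [MvPolynomial.totalDegree_C, zero_add]
  refine (MvPolynomial.totalDegree_finsetProd _ _).trans ?_
  refine le_trans (Finset.sum_le_sum fun i _ => (MvPolynomial.totalDegree_pow _ _).trans
    (Nat.mul_le_mul_left _ (hg i))) ?_
  simp only [mul_one]
  exact MvPolynomial.le_totalDegree hd

/-- The `x^N`-coefficient of a fibre polynomial is the `p₀^N`-coefficient, for `N ≥ totalDegree`. [folklore] -/
theorem coeff_fibre_top {n : ℕ} (D : MvPolynomial (Fin (n + 1)) ℝ) (N : ℕ) (hN : D.totalDegree ≤ N) (q : Fin n → ℝ) :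
    (Polynomial.map (MvPolynomial.eval q) (MvPolynomial.finSuccEquiv ℝ n D)).coeff N =
      MvPolynomial.coeff (Finsupp.single 0 N) D := by
  rw [Polynomial.coeff_map]
  have hc0 : MvPolynomial.coeff 0 ((MvPolynomial.finSuccEquiv ℝ n D).coeff N) =
      MvPolynomial.coeff (Finsupp.single 0 N) D := by
    rw [MvPolynomial.finSuccEquiv_coeff_coeff, Finsupp.cons_zero_eq_single_zero]
  by_cases hz : (MvPolynomial.finSuccEquiv ℝ n D).coeff N = 0
  · rw [hz, map_zero, ← hc0, hz, MvPolynomial.coeff_zero]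
  · have htd := MvPolynomial.totalDegree_coeff_finSuccEquiv_add_le D N hz
    have htd0 : ((MvPolynomial.finSuccEquiv ℝ n D).coeff N).totalDegree = 0 := by omega
    rw [MvPolynomial.totalDegree_eq_zero_iff_eq_C] at htd0
    rw [htd0, MvPolynomial.eval_C, hc0]

/-- **The `x^N`-coefficient of the planar restriction is the `p₀^N`-coefficient of `D`** (§C), for `N ≥ totalDegree D`. [folklore] -/
theorem coeff_top_planarRestriction (D : MvPolynomial (Fin 4) ℝ) (N : ℕ) (hN : D.totalDegree ≤ N) (a : ℝ) (q₀ : Fin 4 → ℝ) :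
    MvPolynomial.coeff (Finsupp.single 0 N) (MvPolynomial.bind₁ (fun i : Fin 4 => if i = 0 then
      (MvPolynomial.X 0 : MvPolynomial (Fin 2) ℝ) else MvPolynomial.C a * MvPolynomial.X 1 + MvPolynomial.C (q₀ i)) D) =
      MvPolynomial.coeff (Finsupp.single 0 N) D := by
  set b := MvPolynomial.bind₁ (fun i : Fin 4 => if i = 0 then
      (MvPolynomial.X 0 : MvPolynomial (Fin 2) ℝ) else MvPolynomial.C a * MvPolynomial.X 1 + MvPolynomial.C (q₀ i)) D with hb
  have hbN : b.totalDegree ≤ N := (totalDegree_planarRestriction_le D a q₀).trans hN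
  -- the two fibre polynomials agree
  have hfib : Polynomial.map (MvPolynomial.eval (fun _ : Fin 1 => (0 : ℝ))) (MvPolynomial.finSuccEquiv ℝ 1 b) =
      Polynomial.map (MvPolynomial.eval (fun i : Fin 3 => q₀ i.succ)) (MvPolynomial.finSuccEquiv ℝ 3 D) := by
    apply Polynomial.funext
    intro x
    rw [← MvPolynomial.eval_eq_eval_mv_eval', ← MvPolynomial.eval_eq_eval_mv_eval']
    have hpt1 : (Fin.cons x (fun _ : Fin 1 => (0 : ℝ)) : Fin 2 → ℝ) = fun i => if i = 0 then x else 0 := by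
      funext i; refine Fin.cases ?_ (fun j => ?_) i
      · rfl
      · simp only [Fin.cons_succ, Fin.succ_ne_zero, if_false]
    have hpt2 : (Fin.cons x (fun i : Fin 3 => q₀ i.succ) : Fin 4 → ℝ) =
        fun i : Fin 4 => if i = 0 then (fun i : Fin 2 => if i = 0 then x else (0 : ℝ)) 0
          else a * (fun i : Fin 2 => if i = 0 then x else (0 : ℝ)) 1 + q₀ i := by
      funext i; refine Fin.cases ?_ (fun j => ?_) i
      · simp
      · simp [Fin.succ_ne_zero]
    rw [hpt1, hb, eval_planarRestriction, hpt2]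
  rw [← coeff_fibre_top b N hbN (fun _ => 0), hfib, coeff_fibre_top D N hN]

/-- **Fibrewise imaginary roots of the planar restriction** (§D): from `WickAlong e₀ D` (unfolded, `e₀ = (1,0,0,0)`). [folklore] -/
theorem planarRestriction_roots_imaginary (D : MvPolynomial (Fin 4) ℝ) (a : ℝ) (q₀ : Fin 4 → ℝ)
    (hW : ∀ q : Fin 4 → ℝ, (∑ i, q i * (fun i : Fin 4 => if i = 0 then (1 : ℝ) else 0) i) = 0 →
      ∀ z : ℂ, MvPolynomial.aeval (fun i => z * ((fun i : Fin 4 => if i = 0 then (1 : ℝ) else 0) i : ℂ) + (q i : ℂ)) D = 0 →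
        z.re = 0) :
    ∀ (y : ℝ) (z : ℂ), MvPolynomial.aeval (fun i : Fin 2 => if i = 0 then z else (y : ℂ))
      (MvPolynomial.bind₁ (fun i : Fin 4 => if i = 0 then (MvPolynomial.X 0 : MvPolynomial (Fin 2) ℝ)
        else MvPolynomial.C a * MvPolynomial.X 1 + MvPolynomial.C (q₀ i)) D) = 0 → z.re = 0 := by
  intro y z hz
  set q : Fin 4 → ℝ := fun i => if i = 0 then 0 else a * y + q₀ i with hq
  have hq0 : (∑ i, q i * (fun i : Fin 4 => if i = 0 then (1 : ℝ) else 0) i) = 0 := by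
    simp [hq]
  apply hW q hq0 z
  rw [MvPolynomial.aeval_bind₁] at hz
  have hpt : (fun i : Fin 4 => z * (((fun i : Fin 4 => if i = 0 then (1 : ℝ) else 0) i : ℝ) : ℂ) + (q i : ℂ)) =
      fun i : Fin 4 => MvPolynomial.aeval (fun i : Fin 2 => if i = 0 then z else (y : ℂ))
        ((fun i : Fin 4 => if i = 0 then (MvPolynomial.X 0 : MvPolynomial (Fin 2) ℝ)
          else MvPolynomial.C a * MvPolynomial.X 1 + MvPolynomial.C (q₀ i)) i) := by
    funext i
    by_cases hi : i = 0
    · simp [hi, hq]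
    · simp [hi, hq]
  rw [hpt]
  exact hz

end Summit.QuantumFields.YangMills.Theorems.RationalShortRootRigidity
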